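import Literature.NumberTheory.LFunctions.RieszMeanPerron
import HarnessLib

/-!
# Riesz means of order one of a Dirichlet series: Perron's formula, main term, differencing

Topic `Literature/NumberTheory/LFunctions`. Everything in this file is PROVED. It supplies the
three elementary ingredients of Landau's 1903 route to prime number theorems with error term
(Landau, Math. Ann. 56 (1903), Part I §§5–8 for `ζ`, Part II §§12–13 for `ζ_K`: an absolutely
convergent Perron integral for a Riesz mean of order one, a contour shift, and a differencing
step), in the Cesàro normalisation of Montgomery–Vaughan §5.1, (5.19) (`k = 1`):

* `sum_mul_sub_eq_integral_LSeries` — **Perron's formula of order one** for an arbitrary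
  Dirichlet series `∑ f(n) n^{-s}` absolutely convergent at `σ > 0`: for `x > 0`,
  `∑_{n ≤ x} f(n)(x − n) = (1/2π) ∫_{−∞}^{∞} x^{1+s} L(f, s) dt/(s(s+1))`, `s = σ + it`
  (MV (5.19) with `k = 1`; the case `f = Λ` is `Literature.NumberTheory.LFunctions.rieszMean_vonMangoldt_eq_integral_LSeries`
  in `RieszMeanPerron.lean`, whose proof we follow);
* `integral_mainTerm` — the **main term**: for `x ≥ 1`, `σ > 1`,
  `(1/2π) ∫ x^{1+s} /((s−1)s(s+1)) dt = (x − 1)²/2` (the polar part `1/(s−1)` of `L(f,s)`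
  contributes `(x−1)²/2 = ∫₁ˣ (u − 1) du`), from the kernel evaluation
  `(1/2πi)∫_{(σ)} y^{-s} ds/(s(s+1)) = (1 − y)⁺` (`Literature.NumberTheory.LFunctions.mellinInv_kernel_eq`) used twice;
* `sub_mul_sum_le_sub` / `sub_le_sub_mul_sum` — the **differencing inequalities** for
  non-negative coefficients: `(y − x) A(x) ≤ C₁(y) − C₁(x) ≤ (y − x) A(y)` for `0 ≤ x ≤ y`, where
  `A(x) = ∑_{n ≤ x} a_n`, `C₁(x) = ∑_{n ≤ x} a_n (x − n)` (Landau 1903 §8).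

These are consumed by `ClassicalPsiErrorTerm.lean` (`ψ(x) = x + O(x e^{−c√log x})` for a
Dirichlet series with non-negative coefficients, a simple pole at `1` and a classical zero-free
region) and thereby by the prime ideal theorem.

## References

* H. L. Montgomery, R. C. Vaughan, *Multiplicative Number Theory I. Classical Theory*, CUP 2007,
  §5.1, (5.17)–(5.19) (`MontgomeryVaughan2007`).
* E. Landau, *Neuer Beweis des Primzahlsatzes und Beweis des Primidealsatzes*, Math. Ann. 56
  (1903), 645–670, §§5–8, §§12–13 (`LandauMathAnn1903`).
-/

noncomputable section

open Complex Filter Set MeasureTheory Real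
open scoped Topology

namespace Literature.NumberTheory.LFunctions

namespace RieszMean

/-! ## Perron's formula of order one for a general Dirichlet series -/

/-- One term: for `x > 0`, `σ > 0`, `n ≥ 1` and any coefficient sequence `f`,
`f(n) (x − n)⁺ = (1/2π) ∫ x^{1+σ+it} f(n) n^{−(σ+it)} dt/((σ+it)(σ+1+it))`
(the kernel evaluation `Literature.NumberTheory.LFunctions.mellinInv_kernel_eq` at `y = n/x`). [folklore] -/
theorem apply_mul_posPart_eq_integral (f : ℕ → ℂ) {x : ℝ} (hx : 0 < x) {σ : ℝ} (hσ : 0 < σ)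
    {n : ℕ} (hn : n ≠ 0) :
    f n * ((max (x - n) 0 : ℝ) : ℂ) =
      (1 / (2 * π) : ℂ) * ∫ t : ℝ, (x : ℂ) ^ (1 + (σ + t * I)) *
        LSeries.term f (σ + t * I) n * (1 / ((σ + t * I) * (σ + t * I + 1))) := by
  have hn0 : (0 : ℝ) < n := Nat.cast_pos.2 (Nat.pos_of_ne_zero hn)
  have hy : 0 < (n : ℝ) / x := div_pos hn0 hx
  have hK := Literature.NumberTheory.LFunctions.mellinInv_kernel_eq hσ hy
  unfold mellinInv at hK
  have hmax : (x : ℝ) * max (1 - n / x) 0 = max (x - n) 0 := by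
    rw [mul_max_of_nonneg _ _ hx.le, mul_sub, mul_one, mul_div_cancel₀ _ hx.ne', mul_zero]
  have hlhs : f n * ((max (x - n) 0 : ℝ) : ℂ) =
      f n * (x : ℂ) * ((max (1 - (n : ℝ) / x) 0 : ℝ) : ℂ) := by
    rw [← hmax]; push_cast; ring
  rw [hlhs, ← hK, Complex.real_smul]
  have hx0 : (x : ℂ) ≠ 0 := ofReal_ne_zero.2 hx.ne'
  have hnC : (n : ℂ) ≠ 0 := Nat.cast_ne_zero.2 hn
  have hpt : ∀ t : ℝ, f n * (x : ℂ) *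
      (((n : ℂ) / (x : ℂ)) ^ (-((σ : ℂ) + t * I)) •
        (1 / (((σ : ℂ) + t * I) * ((σ : ℂ) + t * I + 1)))) =
      (x : ℂ) ^ (1 + (σ + t * I)) * LSeries.term f (σ + t * I) n *
        (1 / ((σ + t * I) * (σ + t * I + 1))) := by
    intro t
    set s : ℂ := σ + t * I with hs
    simp only [smul_eq_mul]
    have hpow : ((n : ℂ) / (x : ℂ)) ^ (-s) = (x : ℂ) ^ s / (n : ℂ) ^ s := by
      rw [show (n : ℂ) / (x : ℂ) = (((n : ℝ) * x⁻¹ : ℝ) : ℂ) by push_cast; ring, cpow_neg,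
        ofReal_mul, mul_cpow_ofReal_nonneg hn0.le (inv_nonneg.2 hx.le), ofReal_inv,
        inv_cpow _ _ ?_, mul_inv, inv_inv]
      · simp only [ofReal_natCast]; ring
      · rw [arg_ofReal_of_nonneg hx.le]; exact Real.pi_pos.ne
    rw [hpow, LSeries.term_of_ne_zero hn]
    conv_rhs => rw [cpow_add _ _ hx0, cpow_one]
    field_simp
  calc f n * (x : ℂ) * ((((1 / (2 * π) : ℝ)) : ℂ) *
        ∫ t : ℝ, (((n : ℝ) / x : ℝ) : ℂ) ^ (-((σ : ℂ) + t * I)) •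
          (fun s : ℂ ↦ 1 / (s * (s + 1))) ((σ : ℂ) + t * I))
      = (((1 / (2 * π) : ℝ)) : ℂ) * ∫ t : ℝ, f n * (x : ℂ) *
          ((((n : ℝ) / x : ℝ) : ℂ) ^ (-((σ : ℂ) + t * I)) •
            (fun s : ℂ ↦ 1 / (s * (s + 1))) ((σ : ℂ) + t * I)) := by
        rw [integral_const_mul]; ring
    _ = _ := by
        push_cast
        congr 1
        exact integral_congr_ae (Eventually.of_forall hpt)

/-- Norm of the `n`-th weighted term on the line `Re s = σ`: `x^{1+σ} ‖f(n) n^{-σ}‖`. [folklore] -/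
theorem norm_cpow_mul_term (f : ℕ → ℂ) {x : ℝ} (hx : 0 < x) (σ t : ℝ) (n : ℕ) :
    ‖(x : ℂ) ^ (1 + (σ + t * I)) * LSeries.term f (σ + t * I) n‖ =
      x ^ (1 + σ) * ‖LSeries.term f σ n‖ := by
  rw [norm_mul]
  congr 1
  · rw [norm_cpow_eq_rpow_re_of_pos hx]; simp
  · rcases eq_or_ne n 0 with rfl | hn
    · simp [LSeries.term_zero]
    · rw [LSeries.norm_term_eq, LSeries.norm_term_eq]
      simp [hn]

/-- Continuity in `t` of the `n`-th weighted term `x^{1+σ+it} f(n) n^{-(σ+it)}`. [folklore] -/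
theorem continuous_cpow_mul_term (f : ℕ → ℂ) {x : ℝ} (hx : 0 < x) (σ : ℝ) (n : ℕ) :
    Continuous fun t : ℝ ↦ (x : ℂ) ^ (1 + (σ + t * I)) * LSeries.term f (σ + t * I) n := by
  have hx0 : (x : ℂ) ≠ 0 := ofReal_ne_zero.2 hx.ne'
  refine Continuous.mul ?_ ?_
  · refine continuous_iff_continuousAt.2 fun t ↦ ?_
    exact (continuousAt_const_cpow hx0).comp (f := fun t : ℝ ↦ 1 + ((σ : ℂ) + t * I))
      (by fun_prop)
  · rcases eq_or_ne n 0 with rfl | hn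
    · simp only [LSeries.term_zero]; exact continuous_const
    · simp only [LSeries.term_of_ne_zero hn]
      refine continuous_const.div ?_ fun t ↦ ?_
      · refine continuous_iff_continuousAt.2 fun t ↦ ?_
        exact (continuousAt_const_cpow (Nat.cast_ne_zero.2 hn)).comp
          (f := fun t : ℝ ↦ ((σ : ℂ) + t * I)) (by fun_prop)
      · exact cpow_ne_zero_iff.2 (Or.inl (Nat.cast_ne_zero.2 hn))

/-- **Perron's formula of order one** (Montgomery–Vaughan (5.19), `k = 1`): if `∑ f(n) n^{-σ}`
converges absolutely, `σ > 0`, then for every `x > 0`,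
`∑_{n ≤ x} f(n) (x − n) = (1/2π) ∫_{−∞}^{∞} x^{1+s} L(f, s) dt/(s(s+1))`, `s = σ + it`, the
integral converging absolutely. [cite: MontgomeryVaughan2007, §5.1 (5.19)] -/
theorem sum_mul_sub_eq_integral_LSeries (f : ℕ → ℂ) {x : ℝ} (hx : 0 < x) {σ : ℝ} (hσ : 0 < σ)
    (hsum : LSeriesSummable f σ) :
    ∑ n ∈ Finset.Ioc 0 ⌊x⌋₊, f n * ((x : ℂ) - n) =
      (1 / (2 * π) : ℂ) * ∫ t : ℝ, (x : ℂ) ^ (1 + (σ + t * I)) *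
        LSeries f (σ + t * I) * (1 / ((σ + t * I) * (σ + t * I + 1))) := by
  set K : ℝ → ℂ := fun t ↦ 1 / (((σ : ℂ) + t * I) * ((σ : ℂ) + t * I + 1)) with hK
  set G : ℕ → ℝ → ℂ := fun n t ↦ (x : ℂ) ^ (1 + (σ + t * I)) * LSeries.term f (σ + t * I) n
    with hG
  set F : ℕ → ℝ → ℂ := fun n t ↦ G n t * K t with hF
  have hnormG : ∀ n t, ‖G n t‖ = x ^ (1 + σ) * ‖LSeries.term f σ n‖ := fun n t ↦
    norm_cpow_mul_term f hx σ t n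
  have hcontG : ∀ n, Continuous (G n) := fun n ↦ continuous_cpow_mul_term f hx σ n
  have hintK : Integrable K := Literature.NumberTheory.LFunctions.integrable_kernel hσ
  have hintF : ∀ n, Integrable (F n) := fun n ↦
    hintK.bdd_mul (hcontG n).aestronglyMeasurable (Eventually.of_forall fun t ↦ (hnormG n t).le)
  have hsumF : Summable fun n ↦ ∫ t, ‖F n t‖ := by
    have hS : Summable fun n ↦ ‖LSeries.term f σ n‖ := hsum.norm
    have := (hS.mul_left (x ^ (1 + σ))).mul_right (∫ t : ℝ, ‖K t‖)
    refine this.congr fun n ↦ ?_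
    rw [← integral_const_mul]
    refine integral_congr_ae (Eventually.of_forall fun t ↦ ?_)
    simp only [hF, norm_mul, hnormG n t]
  -- the terms, with the (absent) `n = 0` term set to `0`
  set g : ℕ → ℂ := fun n ↦ if n = 0 then 0 else f n * ((max (x - n) 0 : ℝ) : ℂ) with hg
  have hterm : ∀ n : ℕ, g n = (1 / (2 * π) : ℂ) * ∫ t, F n t := by
    intro n
    rcases eq_or_ne n 0 with rfl | hn
    · simp [hg, hF, hG, LSeries.term_zero]
    · simp only [hg, if_neg hn]
      exact apply_mul_posPart_eq_integral f hx hσ hn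
  have hlhs : ∑ n ∈ Finset.Ioc 0 ⌊x⌋₊, f n * ((x : ℂ) - n) = ∑' n : ℕ, g n := by
    rw [tsum_eq_sum (s := Finset.Ioc 0 ⌊x⌋₊)]
    · refine Finset.sum_congr rfl fun n hn ↦ ?_
      rw [Finset.mem_Ioc] at hn
      have hnx : (n : ℝ) ≤ x := (Nat.cast_le.2 hn.2).trans (Nat.floor_le hx.le)
      simp only [hg, if_neg hn.1.ne', max_eq_left (sub_nonneg.2 hnx)]
      push_cast; ring
    · intro n hn
      rw [Finset.mem_Ioc, not_and_or, not_lt, not_le] at hn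
      rcases hn with hn | hn
      · simp [hg, Nat.le_zero.1 hn]
      · have hxn : x < n := by
          have := Nat.lt_of_floor_lt hn
          exact_mod_cast this
        have hn0 : n ≠ 0 := by rintro rfl; simp at hn
        simp only [hg, if_neg hn0, max_eq_right (sub_nonpos.2 hxn.le)]
        simp
  rw [hlhs, tsum_congr hterm, tsum_mul_left, integral_tsum_of_summable_integral_norm hintF hsumF]
  congr 1
  refine integral_congr_ae (Eventually.of_forall fun t ↦ ?_)
  simp only [hF, hG, hK]
  rw [LSeries, ← tsum_mul_left, ← tsum_mul_right]

/-- Real-coefficient form of Perron's formula of order one: for `a : ℕ → ℝ` with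
`∑ |a(n)| n^{-σ} < ∞`, `σ > 0`, `x > 0`,
`∑_{n ≤ x} a(n)(x − n) = (1/2π) ∫ x^{1+s} L(a, s) dt/(s(s+1))`. [cite: MontgomeryVaughan2007, §5.1 (5.19)] -/
theorem sum_mul_sub_eq_integral_LSeries_real (a : ℕ → ℝ) {x : ℝ} (hx : 0 < x) {σ : ℝ}
    (hσ : 0 < σ) (hsum : LSeriesSummable (fun n ↦ (a n : ℂ)) σ) :
    ((∑ n ∈ Finset.Ioc 0 ⌊x⌋₊, a n * (x - n) : ℝ) : ℂ) =
      (1 / (2 * π) : ℂ) * ∫ t : ℝ, (x : ℂ) ^ (1 + (σ + t * I)) *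
        LSeries (fun n ↦ (a n : ℂ)) (σ + t * I) * (1 / ((σ + t * I) * (σ + t * I + 1))) := by
  rw [← sum_mul_sub_eq_integral_LSeries _ hx hσ hsum]
  push_cast
  rfl

/-! ## The main term `(x − 1)²/2` -/

/-- `x^{σ+it} = x · x^{(σ−1)+it}` for `x > 0`. [folklore] -/
theorem cpow_line_eq_mul {x : ℝ} (hx : 0 < x) (σ t : ℝ) :
    (x : ℂ) ^ ((σ : ℂ) + t * I) = (x : ℂ) * (x : ℂ) ^ ((((σ - 1 : ℝ)) : ℂ) + t * I) := by
  have hx0 : (x : ℂ) ≠ 0 := ofReal_ne_zero.2 hx.ne'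
  rw [show ((σ : ℂ) + t * I) = 1 + ((((σ - 1 : ℝ)) : ℂ) + t * I) by push_cast; ring,
    cpow_add _ _ hx0, cpow_one]

/-- The kernel evaluation in the variable `x = 1/y`: for `σ > 0`, `x > 0`,
`(1/2π) ∫ x^{σ+it} dt/((σ+it)(σ+1+it)) = (1 − 1/x)⁺` (`Literature.NumberTheory.LFunctions.mellinInv_kernel_eq`). [folklore] -/
theorem integral_cpow_mul_kernel {σ : ℝ} (hσ : 0 < σ) {x : ℝ} (hx : 0 < x) :
    (1 / (2 * π) : ℂ) * ∫ t : ℝ, (x : ℂ) ^ ((σ : ℂ) + t * I) *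
        (1 / (((σ : ℂ) + t * I) * ((σ : ℂ) + t * I + 1))) = ((max (1 - x⁻¹) 0 : ℝ) : ℂ) := by
  have hK := Literature.NumberTheory.LFunctions.mellinInv_kernel_eq hσ (inv_pos.2 hx)
  unfold mellinInv at hK
  rw [← hK, Complex.real_smul]
  push_cast
  congr 1
  refine integral_congr_ae (Eventually.of_forall fun t ↦ ?_)
  simp only [smul_eq_mul]
  congr 1
  rw [← ofReal_inv, show ((x⁻¹ : ℝ) : ℂ) = (x : ℂ)⁻¹ by push_cast; rfl, inv_cpow _ _ ?_, cpow_neg,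
    inv_inv]
  rw [arg_ofReal_of_nonneg hx.le]; exact Real.pi_pos.ne

/-- The shifted kernel: for `σ > 1`, `x > 0`,
`(1/2π) ∫ x^{σ+it} dt/((σ−1+it)(σ+it)) = x (1 − 1/x)⁺` (substitute `s = 1 + w`). [folklore] -/
theorem integral_cpow_mul_kernel_sub_one {σ : ℝ} (hσ : 1 < σ) {x : ℝ} (hx : 0 < x) :
    (1 / (2 * π) : ℂ) * ∫ t : ℝ, (x : ℂ) ^ ((σ : ℂ) + t * I) *
        (1 / (((σ : ℂ) + t * I - 1) * ((σ : ℂ) + t * I))) =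
      (x : ℂ) * ((max (1 - x⁻¹) 0 : ℝ) : ℂ) := by
  have h1 := integral_cpow_mul_kernel (σ := σ - 1) (by linarith) hx
  calc (1 / (2 * π) : ℂ) * ∫ t : ℝ, (x : ℂ) ^ ((σ : ℂ) + t * I) *
        (1 / (((σ : ℂ) + t * I - 1) * ((σ : ℂ) + t * I)))
      = (1 / (2 * π) : ℂ) * ∫ t : ℝ, (x : ℂ) * ((x : ℂ) ^ ((((σ - 1 : ℝ)) : ℂ) + t * I) *
          (1 / (((((σ - 1 : ℝ)) : ℂ) + t * I) * ((((σ - 1 : ℝ)) : ℂ) + t * I + 1)))) := by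
        congr 1
        refine integral_congr_ae (Eventually.of_forall fun t : ℝ ↦ ?_)
        show (x : ℂ) ^ ((σ : ℂ) + t * I) * (1 / (((σ : ℂ) + t * I - 1) * ((σ : ℂ) + t * I))) =
          (x : ℂ) * ((x : ℂ) ^ ((((σ - 1 : ℝ)) : ℂ) + t * I) *
            (1 / (((((σ - 1 : ℝ)) : ℂ) + t * I) * ((((σ - 1 : ℝ)) : ℂ) + t * I + 1))))
        rw [cpow_line_eq_mul hx σ t]
        push_cast
        ring_nf
    _ = (x : ℂ) * ((1 / (2 * π) : ℂ) * ∫ t : ℝ, (x : ℂ) ^ ((((σ - 1 : ℝ)) : ℂ) + t * I) *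
          (1 / (((((σ - 1 : ℝ)) : ℂ) + t * I) * ((((σ - 1 : ℝ)) : ℂ) + t * I + 1)))) := by
        rw [integral_const_mul]; ring
    _ = (x : ℂ) * ((max (1 - x⁻¹) 0 : ℝ) : ℂ) := by rw [h1]

/-- Integrability of `t ↦ x^{σ+it}/((σ+it)(σ+1+it))` for `σ > 0`, `x > 0`. [folklore] -/
theorem integrable_cpow_mul_kernel {σ : ℝ} (hσ : 0 < σ) {x : ℝ} (hx : 0 < x) :
    Integrable fun t : ℝ ↦ (x : ℂ) ^ ((σ : ℂ) + t * I) *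
      (1 / (((σ : ℂ) + t * I) * ((σ : ℂ) + t * I + 1))) := by
  have hx0 : (x : ℂ) ≠ 0 := ofReal_ne_zero.2 hx.ne'
  refine (Literature.NumberTheory.LFunctions.integrable_kernel hσ).bdd_mul (c := x ^ σ) ?_ (Eventually.of_forall fun t ↦ ?_)
  · refine Continuous.aestronglyMeasurable (continuous_iff_continuousAt.2 fun t ↦ ?_)
    exact (continuousAt_const_cpow hx0).comp (f := fun t : ℝ ↦ ((σ : ℂ) + t * I)) (by fun_prop)
  · rw [norm_cpow_eq_rpow_re_of_pos hx]; simp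

/-- Integrability of `t ↦ x^{σ+it}/((σ−1+it)(σ+it))` for `σ > 1`, `x > 0`. [folklore] -/
theorem integrable_cpow_mul_kernel_sub_one {σ : ℝ} (hσ : 1 < σ) {x : ℝ} (hx : 0 < x) :
    Integrable fun t : ℝ ↦ (x : ℂ) ^ ((σ : ℂ) + t * I) *
      (1 / (((σ : ℂ) + t * I - 1) * ((σ : ℂ) + t * I))) := by
  have h1 := (integrable_cpow_mul_kernel (σ := σ - 1) (by linarith) hx).const_mul (x : ℂ)
  refine h1.congr (Eventually.of_forall fun t ↦ ?_)
  simp only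
  rw [cpow_line_eq_mul hx σ t]
  push_cast
  ring_nf

/-- **The main term.** For `x ≥ 1` and `σ > 1`,
`(1/2π) ∫_{−∞}^{∞} x^{1+s} /((s−1) s (s+1)) dt = (x − 1)²/2`, `s = σ + it`: the contribution of
the pole `1/(s − 1)` of the Dirichlet series to the Riesz mean `∑_{n ≤ x} a_n (x − n)`
(`= ∫₁ˣ (u − 1) du`, the Riesz mean of the main term `u − 1` of `A(u)`). From
`1/((s−1)s(s+1)) = ½ (1/((s−1)s) − 1/(s(s+1)))` and the two kernel evaluations above.
[cite: MontgomeryVaughan2007, §5.1 (5.19)] -/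
theorem integral_mainTerm {x : ℝ} (hx : 1 ≤ x) {σ : ℝ} (hσ : 1 < σ) :
    (1 / (2 * π) : ℂ) * ∫ t : ℝ, (x : ℂ) ^ (1 + ((σ : ℂ) + t * I)) * (1 / ((σ : ℂ) + t * I - 1)) *
        (1 / (((σ : ℂ) + t * I) * ((σ : ℂ) + t * I + 1))) = ((((x - 1) ^ 2 / 2 : ℝ)) : ℂ) := by
  have hx0' : 0 < x := by linarith
  have hx0 : (x : ℂ) ≠ 0 := ofReal_ne_zero.2 hx0'.ne'
  have hσ0 : 0 < σ := by linarith
  set A : ℝ → ℂ := fun t ↦ (x : ℂ) ^ ((σ : ℂ) + t * I) *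
    (1 / (((σ : ℂ) + t * I - 1) * ((σ : ℂ) + t * I))) with hA
  set B : ℝ → ℂ := fun t ↦ (x : ℂ) ^ ((σ : ℂ) + t * I) *
    (1 / (((σ : ℂ) + t * I) * ((σ : ℂ) + t * I + 1))) with hB
  have hne : ∀ t : ℝ, ((σ : ℂ) + t * I - 1) ≠ 0 ∧ ((σ : ℂ) + t * I) ≠ 0 ∧
      ((σ : ℂ) + t * I + 1) ≠ 0 := by
    intro t
    refine ⟨fun h ↦ ?_, fun h ↦ ?_, fun h ↦ ?_⟩ <;>
    · have := congrArg Complex.re h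
      simp at this
      linarith
  have hpt : ∀ t : ℝ, (x : ℂ) ^ (1 + ((σ : ℂ) + t * I)) * (1 / ((σ : ℂ) + t * I - 1)) *
      (1 / (((σ : ℂ) + t * I) * ((σ : ℂ) + t * I + 1))) = ((x : ℂ) / 2) * (A t - B t) := by
    intro t
    obtain ⟨h1, h2, h3⟩ := hne t
    simp only [hA, hB]
    rw [cpow_add _ _ hx0, cpow_one]
    field_simp
    ring
  have hIA := integral_cpow_mul_kernel_sub_one hσ hx0'
  have hIB := integral_cpow_mul_kernel hσ0 hx0'
  have hintA := integrable_cpow_mul_kernel_sub_one hσ hx0'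
  have hintB := integrable_cpow_mul_kernel hσ0 hx0'
  rw [integral_congr_ae (Eventually.of_forall hpt), integral_const_mul, integral_sub hintA hintB]
  simp only [← hA, ← hB] at hIA hIB ⊢
  have hm : max (1 - x⁻¹) 0 = 1 - x⁻¹ := max_eq_left (by
    rw [sub_nonneg]; exact inv_le_one_of_one_le₀ hx)
  calc (1 / (2 * π) : ℂ) * ((x : ℂ) / 2 * ((∫ a, A a) - ∫ a, B a))
      = (x : ℂ) / 2 * ((1 / (2 * π) : ℂ) * (∫ a, A a) - (1 / (2 * π) : ℂ) * ∫ a, B a) := by ring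
    _ = (x : ℂ) / 2 * ((x : ℂ) * ((max (1 - x⁻¹) 0 : ℝ) : ℂ) - ((max (1 - x⁻¹) 0 : ℝ) : ℂ)) := by
        rw [hIA, hIB]
    _ = ((((x - 1) ^ 2 / 2 : ℝ)) : ℂ) := by
        rw [hm]
        push_cast
        field_simp

/-! ## Differencing inequalities for non-negative coefficients -/

/-- The summatory function `A(x) = ∑_{n ≤ x} a_n` is monotone for `a ≥ 0`. [folklore] -/
theorem sum_Ioc_floor_mono {a : ℕ → ℝ} (ha : ∀ n, 0 ≤ a n) {x y : ℝ} (hxy : x ≤ y) :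
    ∑ n ∈ Finset.Ioc 0 ⌊x⌋₊, a n ≤ ∑ n ∈ Finset.Ioc 0 ⌊y⌋₊, a n :=
  Finset.sum_le_sum_of_subset_of_nonneg
    (Finset.Ioc_subset_Ioc_right (Nat.floor_le_floor hxy)) fun n _ _ ↦ ha n

/-- The summatory function `A(x) = ∑_{n ≤ x} a_n` is non-negative for `a ≥ 0`. [folklore] -/
theorem sum_Ioc_floor_nonneg {a : ℕ → ℝ} (ha : ∀ n, 0 ≤ a n) (x : ℝ) :
    0 ≤ ∑ n ∈ Finset.Ioc 0 ⌊x⌋₊, a n :=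
  Finset.sum_nonneg fun n _ ↦ ha n

/-- Splitting the Riesz mean at `x ≤ y`:
`C₁(y) − C₁(x) = (y − x) A(x) + ∑_{x < n ≤ y} a_n (y − n)`. [folklore] -/
theorem rieszMean_sub_rieszMean_eq (a : ℕ → ℝ) {x y : ℝ} (hxy : x ≤ y) :
    (∑ n ∈ Finset.Ioc 0 ⌊y⌋₊, a n * (y - n)) - ∑ n ∈ Finset.Ioc 0 ⌊x⌋₊, a n * (x - n) =
      (y - x) * ∑ n ∈ Finset.Ioc 0 ⌊x⌋₊, a n +
        ∑ n ∈ Finset.Ioc ⌊x⌋₊ ⌊y⌋₊, a n * (y - n) := by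
  rw [← Finset.sum_Ioc_consecutive _ (Nat.zero_le _) (Nat.floor_le_floor hxy), Finset.mul_sum]
  have : ∑ n ∈ Finset.Ioc 0 ⌊x⌋₊, a n * (y - n) - ∑ n ∈ Finset.Ioc 0 ⌊x⌋₊, a n * (x - n) =
      ∑ n ∈ Finset.Ioc 0 ⌊x⌋₊, (y - x) * a n := by
    rw [← Finset.sum_sub_distrib]
    refine Finset.sum_congr rfl fun n _ ↦ ?_
    ring
  linarith

/-- **Lower differencing inequality** (Landau 1903 §8): for `a ≥ 0` and `0 ≤ x ≤ y`,
`(y − x) A(x) ≤ C₁(y) − C₁(x)`. [cite: LandauMathAnn1903, §8] -/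
theorem sub_mul_sum_le_sub {a : ℕ → ℝ} (ha : ∀ n, 0 ≤ a n) {x y : ℝ} (hy : 0 ≤ y) (hxy : x ≤ y) :
    (y - x) * ∑ n ∈ Finset.Ioc 0 ⌊x⌋₊, a n ≤
      (∑ n ∈ Finset.Ioc 0 ⌊y⌋₊, a n * (y - n)) - ∑ n ∈ Finset.Ioc 0 ⌊x⌋₊, a n * (x - n) := by
  rw [rieszMean_sub_rieszMean_eq a hxy, le_add_iff_nonneg_right]
  refine Finset.sum_nonneg fun n hn ↦ mul_nonneg (ha n) ?_
  rw [Finset.mem_Ioc] at hn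
  have : (n : ℝ) ≤ y := (Nat.cast_le.2 hn.2).trans (Nat.floor_le hy)
  linarith

/-- **Upper differencing inequality** (Landau 1903 §8): for `a ≥ 0` and `0 ≤ x ≤ y`,
`C₁(y) − C₁(x) ≤ (y − x) A(y)`. [cite: LandauMathAnn1903, §8] -/
theorem sub_le_sub_mul_sum {a : ℕ → ℝ} (ha : ∀ n, 0 ≤ a n) {x y : ℝ} (hxy : x ≤ y) :
    (∑ n ∈ Finset.Ioc 0 ⌊y⌋₊, a n * (y - n)) - ∑ n ∈ Finset.Ioc 0 ⌊x⌋₊, a n * (x - n) ≤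
      (y - x) * ∑ n ∈ Finset.Ioc 0 ⌊y⌋₊, a n := by
  rw [rieszMean_sub_rieszMean_eq a hxy,
    ← Finset.sum_Ioc_consecutive _ (Nat.zero_le _) (Nat.floor_le_floor hxy), mul_add,
    add_le_add_iff_left, Finset.mul_sum]
  refine Finset.sum_le_sum fun n hn ↦ ?_
  rw [Finset.mem_Ioc] at hn
  have hxn : x < n := by
    have := Nat.lt_of_floor_lt hn.1
    exact_mod_cast this
  rw [mul_comm]
  exact mul_le_mul_of_nonneg_right (by linarith) (ha n)

end RieszMean

end Literature.NumberTheory.LFunctions
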